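import Summits.Ventures.Crystal3D.Theorems.StickyWulffConstantTextureBuildPiecePairs
import Summits.Ventures.Crystal3D.Theorems.StickyWulffConstantPolycrystalWulffBoundMergingCalculus
import HarnessLib

/-!
# TB-D assembly, part 1b: the energy of a PIECEWISE-CONVEX texture is bounded by its PIECE LEDGER
# (lane T, crux `TextureLiminfV5`, stmt-Ventures-23912; design memo TB-D-0 §4 "energy localisation")

HONEST FRAMING. Venture `Summits/Ventures/Crystal3D` (cell `crystal3d-full`), route `route-Ventures-StickyWulffConstant`, helper `--supports` the
law-v5 crux `TextureLiminfV5` (stmt-Ventures-23912).  Pure continuum bookkeeping on top of the P-lane's facet calculus (…PolycrystalWulffBound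
MergingCalculus: `freeEnergy_eq_merged_texture`, `two_iota_biUnion_biUnion`) and part 1a (…TextureBuildPiecePairs), using the LANDED
`stub_polytopeCalculus` (so the bound is unconditional; `stub_TB_energy`'s `PolytopeCalculus →` binder is simply not needed); census-free, standard axioms; nothing about any cover or mesh; F-C1 not moved.

THE STATEMENT (`energy_le_pieceLedger`).  A texture `(n, G, A, c, m)` whose grains are unions of PIECES — pairwise disjoint bounded open
`H`-polytopes `P μ = polytope (Hp μ)`, `μ : Fin M`, unit facet normals, pairwise distinct facet planes, `G ℓ = ⋃_{cls μ = ℓ} P μ` — has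

  `energy n G A c m ≤ Σ_μ Σ_{p ∈ Hp μ} h_{W(cls μ)}(p.1) · facetArea (F μ p ∖ ⋃_{μ' ≠ μ} cl P μ') p.1`                       (free: EXPOSED facets only)
  `              + Σ_μ Σ_{μ' : cls μ' ≠ cls μ} (c (cls μ) (cls μ') / 2) · Σ_{p ∈ Hp μ} h_{D(m (cls μ) (cls μ'))}(p.1) · facetArea (F μ p ∩ cl P μ') p.1`   (walls)

(`F μ p = cl P μ ∩ {⟪p.1, x⟫ = p.2}` the facet of piece `μ` on the plane `p`, `W = wulffOf`, `D = wallBody`, `c ≥ 0` off the diagonal).  So: facets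
covered by other pieces are FREE of surface energy (whatever the grains), and a wall between two grains costs at most `c·h_D(ν)·(contact area)`,
booked half on each side's facet.  This is the form in which the TB-D texture (cores, tents, prisms, gap pieces, riser boxes of `Mesh₃`) is paid
for by `tentBudget + chargeSum + riserSum + gapCost` (TB-D-0 §4: (T) exposed tent facets, (C) cut polygons, (R) riser curtains, (D) designated
facets; (B0)/(A)/(I) cost `0` because `h_D(±m) = 0`, `c = 0`, or the facet is covered).
THE PROOF.  (1) free energy is invariant under merging pieces into grains (`freeEnergy_eq_merged_texture`) and walls are bilinear
(`two_iota_biUnion_biUnion`); (2) per piece clause (A); (3) the pair bounds (F)/(W) of part 1a; (4) subadditivity of `facetArea`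
(`facetArea_le_sum_of_subset_iUnion`) and `h ≥ 0`.
-/

noncomputable section

namespace Summit.Ventures.Crystal3D.Cruxes.TextureLiminf.TexShadow

open Summit.Ventures.Crystal3D Summit.Ventures.Crystal3D.Theorems MeasureTheory Set
open scoped InnerProductSpace
open Summit.Ventures.Crystal3D.TentCertificate (phiB_eq_phiFcc)
open Literature.MathematicalPhysics.StatisticalMechanics (phiFcc_nonneg)

/-! ### The piece ledger -/

/-- **The energy of a piecewise-convex texture is bounded by its piece ledger.**  See the module docstring.  Pieces `P μ = polytope (Hp μ)`
(bounded, unit facet normals, pairwise distinct facet planes, pairwise disjoint), class map `cls`, grains `G ℓ = ⋃_{cls μ = ℓ} P μ`, charges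
`c ≥ 0` off the diagonal; then `energy ≤` (exposed facets at `h_{wulffOf}`) `+` (contacts of pieces of different classes at `c/2 · h_{wallBody}`
on each side). -/
theorem energy_le_pieceLedger {n M : ℕ} (G : Fin n → Set E3)
    (A : Fin n → (E3 ≃ₗᵢ[ℝ] E3)) (c : Fin n → Fin n → ℝ) (m : Fin n → Fin n → E3)
    (hc : ∀ ℓ ℓ', ℓ ≠ ℓ' → 0 ≤ c ℓ ℓ')
    (Hp : Fin M → Finset (E3 × ℝ)) (cls : Fin M → Fin n)
    (hbd : ∀ μ, Bornology.IsBounded (polytope (Hp μ)))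
    (hunit : ∀ μ, ∀ p ∈ Hp μ, ‖p.1‖ = 1)
    (hplanes : ∀ μ, ∀ p ∈ Hp μ, ∀ p' ∈ Hp μ, p ≠ p' →
      {x : E3 | ⟪p.1, x⟫_ℝ = p.2} ≠ {x : E3 | ⟪p'.1, x⟫_ℝ = p'.2})
    (hdisj : ∀ μ μ', μ ≠ μ' → Disjoint (polytope (Hp μ)) (polytope (Hp μ')))
    (hG : ∀ ℓ, G ℓ = ⋃ μ ∈ Finset.univ.filter (fun μ => cls μ = ℓ), polytope (Hp μ)) :
    energy n G A c m ≤
      (∑ μ, ∑ p ∈ Hp μ, supportFn (wulffOf (A (cls μ))) p.1 *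
          facetArea ((closure (polytope (Hp μ)) ∩ {x : E3 | ⟪p.1, x⟫_ℝ = p.2}) \
            ⋃ μ' ∈ Finset.univ.erase μ, closure (polytope (Hp μ'))) p.1) +
      ∑ μ, ∑ μ' ∈ Finset.univ.filter (fun μ' => cls μ' ≠ cls μ), c (cls μ) (cls μ') / 2 *
        ∑ p ∈ Hp μ, supportFn (wallBody (m (cls μ) (cls μ'))) p.1 *
          facetArea (closure (polytope (Hp μ)) ∩ {x : E3 | ⟪p.1, x⟫_ℝ = p.2} ∩ closure (polytope (Hp μ'))) p.1 := by
  classical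
  -- the fine texture of pieces
  have hPoly : ∀ μ, ∃ (k : ℕ) (H : Fin k → Finset (E3 × ℝ)), polytope (Hp μ) = ⋃ i, polytope (H i) :=
    fun μ => ⟨1, fun _ => Hp μ, (Set.iUnion_const _).symm⟩
  have hvol : ∀ μ, volume (polytope (Hp μ)) < ⊤ := fun μ => (hbd μ).measure_lt_top
  -- bodies
  have hKc : ∀ ℓ, IsCompact (wulffOf (A ℓ)) := fun ℓ => isCompact_wulffOf (A ℓ)
  have hKv : ∀ ℓ, Convex ℝ (wulffOf (A ℓ)) := fun ℓ => convex_wulffOf (A ℓ)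
  have hK0 : ∀ ℓ, (0 : E3) ∈ wulffOf (A ℓ) := fun ℓ => by
    intro ν
    rw [inner_zero_left, phiB_eq_phiFcc]
    exact phiFcc_nonneg _
  have hKs : ∀ ℓ, -wulffOf (A ℓ) = wulffOf (A ℓ) := fun ℓ => neg_wulffOf (A ℓ)
  -- the energy, unfolded
  have hE : energy n G A c m =
      (∑ ℓ, (per (wulffOf (A ℓ)) (G ℓ) - ∑ ℓ', (if ℓ = ℓ' then 0 else
        (per (wulffOf (A ℓ)) (G ℓ) + per (wulffOf (A ℓ)) (G ℓ') - per (wulffOf (A ℓ)) (G ℓ ∪ G ℓ')) / 2))) +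
      ∑ ℓ, ∑ ℓ', (if ℓ = ℓ' then 0 else c ℓ ℓ' / 2 *
        ((per (wallBody (m ℓ ℓ')) (G ℓ) + per (wallBody (m ℓ ℓ')) (G ℓ') -
          per (wallBody (m ℓ ℓ')) (G ℓ ∪ G ℓ')) / 2)) := by
    simp only [energy, iface, Finset.sum_sub_distrib]
  rw [hE]
  refine add_le_add ?_ ?_
  · ----------------------------------------------------------------- FREE PART
    have hfe : (∑ μ, (per (wulffOf (A (cls μ))) (polytope (Hp μ)) - ∑ μ', (if μ = μ' then 0 else
          (per (wulffOf (A (cls μ))) (polytope (Hp μ)) + per (wulffOf (A (cls μ))) (polytope (Hp μ')) -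
            per (wulffOf (A (cls μ))) (polytope (Hp μ) ∪ polytope (Hp μ'))) / 2))) =
        ∑ ℓ ∈ Finset.univ, (per (wulffOf (A ℓ)) (⋃ μ ∈ Finset.univ.filter (fun μ => cls μ = ℓ), polytope (Hp μ)) -
          ∑ ℓ' ∈ Finset.univ, (if ℓ = ℓ' then 0 else
            (per (wulffOf (A ℓ)) (⋃ μ ∈ Finset.univ.filter (fun μ => cls μ = ℓ), polytope (Hp μ)) +
              per (wulffOf (A ℓ)) (⋃ μ ∈ Finset.univ.filter (fun μ => cls μ = ℓ'), polytope (Hp μ)) -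
              per (wulffOf (A ℓ)) ((⋃ μ ∈ Finset.univ.filter (fun μ => cls μ = ℓ), polytope (Hp μ)) ∪
                ⋃ μ ∈ Finset.univ.filter (fun μ => cls μ = ℓ'), polytope (Hp μ))) / 2)) :=
      freeEnergy_eq_merged_texture (fun μ => polytope (Hp μ)) hPoly hvol hdisj cls Finset.univ
        (fun μ => Finset.mem_univ _) (fun ℓ => wulffOf (A ℓ)) hKc hKv hK0 hKs
    have hmerged : (∑ μ, (per (wulffOf (A (cls μ))) (polytope (Hp μ)) - ∑ μ', (if μ = μ' then 0 else
          (per (wulffOf (A (cls μ))) (polytope (Hp μ)) + per (wulffOf (A (cls μ))) (polytope (Hp μ')) -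
            per (wulffOf (A (cls μ))) (polytope (Hp μ) ∪ polytope (Hp μ'))) / 2))) =
        ∑ ℓ, (per (wulffOf (A ℓ)) (G ℓ) - ∑ ℓ', (if ℓ = ℓ' then 0 else
          (per (wulffOf (A ℓ)) (G ℓ) + per (wulffOf (A ℓ)) (G ℓ') - per (wulffOf (A ℓ)) (G ℓ ∪ G ℓ')) / 2)) := by
      rw [hfe]
      simp only [← hG]
    rw [← hmerged]
    refine Finset.sum_le_sum fun μ _ => ?_
    -- piece `μ`: clause (A), the split exposed/covered, subadditivity of the covered part, and the free pair bound
    obtain ⟨hA, -⟩ := stub_polytopeCalculus (wulffOf (A (cls μ))) (hKc _) (hKv _) (hK0 _)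
    have hAeq := hA (Hp μ) (hbd μ) (hunit μ) (hplanes μ)
    have hsplit : ∀ p ∈ Hp μ,
        facetArea (closure (polytope (Hp μ)) ∩ {x : E3 | ⟪p.1, x⟫_ℝ = p.2}) p.1 ≤
          facetArea ((closure (polytope (Hp μ)) ∩ {x : E3 | ⟪p.1, x⟫_ℝ = p.2}) ∩
              ⋃ μ' ∈ Finset.univ.erase μ, closure (polytope (Hp μ'))) p.1 +
            facetArea ((closure (polytope (Hp μ)) ∩ {x : E3 | ⟪p.1, x⟫_ℝ = p.2}) \
              ⋃ μ' ∈ Finset.univ.erase μ, closure (polytope (Hp μ'))) p.1 :=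
      fun p _ => facetArea_le_add (hbd μ) (fun x hx => hx.1.1) (fun x hx => hx.1.1)
        (fun x hx => by
          by_cases h : x ∈ ⋃ μ' ∈ Finset.univ.erase μ, closure (polytope (Hp μ'))
          exacts [Or.inl ⟨hx, h⟩, Or.inr ⟨hx, h⟩]) p.1
    have hcov : ∀ p ∈ Hp μ,
        facetArea ((closure (polytope (Hp μ)) ∩ {x : E3 | ⟪p.1, x⟫_ℝ = p.2}) ∩
            ⋃ μ' ∈ Finset.univ.erase μ, closure (polytope (Hp μ'))) p.1 ≤
          ∑ μ' ∈ Finset.univ.erase μ, facetArea (closure (polytope (Hp μ)) ∩ {x : E3 | ⟪p.1, x⟫_ℝ = p.2} ∩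
            closure (polytope (Hp μ'))) p.1 :=
      fun p _ => facetArea_le_sum_of_subset_iUnion (Finset.univ.erase μ) _
        (fun μ' => closure (polytope (Hp μ)) ∩ {x : E3 | ⟪p.1, x⟫_ℝ = p.2} ∩ closure (polytope (Hp μ'))) p.1
        (fun x hx => by
          obtain ⟨μ', hμ', hx'⟩ := mem_iUnion₂.1 hx.2
          exact mem_iUnion₂.2 ⟨μ', hμ', hx.1, hx'⟩)
        (fun μ' _ => volume_prism_ne_top_of_isBounded (hbd μ) _ (fun x hx => hx.1.1) p.1)
    have hpair : ∀ μ' ∈ Finset.univ.erase μ,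
        ∑ p ∈ Hp μ, supportFn (wulffOf (A (cls μ))) p.1 * facetArea (closure (polytope (Hp μ)) ∩
            {x : E3 | ⟪p.1, x⟫_ℝ = p.2} ∩ closure (polytope (Hp μ'))) p.1 ≤
          (per (wulffOf (A (cls μ))) (polytope (Hp μ)) + per (wulffOf (A (cls μ))) (polytope (Hp μ')) -
            per (wulffOf (A (cls μ))) (polytope (Hp μ) ∪ polytope (Hp μ'))) / 2 :=
      fun μ' hμ' => facetSum_le_iota_pair (hKc _) (hKv _) (hK0 _) (hKs _) (hbd μ) (hbd μ') (hunit μ)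
        (hplanes μ) (hdisj μ μ' (Finset.ne_of_mem_erase hμ').symm)
    have herase : (∑ μ', (if μ = μ' then 0 else
          (per (wulffOf (A (cls μ))) (polytope (Hp μ)) + per (wulffOf (A (cls μ))) (polytope (Hp μ')) -
            per (wulffOf (A (cls μ))) (polytope (Hp μ) ∪ polytope (Hp μ'))) / 2)) =
        ∑ μ' ∈ Finset.univ.erase μ, (per (wulffOf (A (cls μ))) (polytope (Hp μ)) +
          per (wulffOf (A (cls μ))) (polytope (Hp μ')) - per (wulffOf (A (cls μ))) (polytope (Hp μ) ∪ polytope (Hp μ'))) / 2 := by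
      rw [← Finset.add_sum_erase _ _ (Finset.mem_univ μ), if_pos rfl, zero_add]
      exact Finset.sum_congr rfl fun μ' hμ' => if_neg (Finset.ne_of_mem_erase hμ').symm
    rw [herase]
    have h1 : ∑ p ∈ Hp μ, supportFn (wulffOf (A (cls μ))) p.1 *
          facetArea (closure (polytope (Hp μ)) ∩ {x : E3 | ⟪p.1, x⟫_ℝ = p.2}) p.1 ≤
        ∑ p ∈ Hp μ, supportFn (wulffOf (A (cls μ))) p.1 *
          (∑ μ' ∈ Finset.univ.erase μ, facetArea (closure (polytope (Hp μ)) ∩ {x : E3 | ⟪p.1, x⟫_ℝ = p.2} ∩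
            closure (polytope (Hp μ'))) p.1) +
        ∑ p ∈ Hp μ, supportFn (wulffOf (A (cls μ))) p.1 *
          facetArea ((closure (polytope (Hp μ)) ∩ {x : E3 | ⟪p.1, x⟫_ℝ = p.2}) \
            ⋃ μ' ∈ Finset.univ.erase μ, closure (polytope (Hp μ'))) p.1 := by
      rw [← Finset.sum_add_distrib]
      refine Finset.sum_le_sum fun p hp => ?_
      rw [← mul_add]
      exact mul_le_mul_of_nonneg_left ((hsplit p hp).trans (by linarith [hcov p hp]))
        (supportFn_nonneg (hKc _) (hK0 _) _)
    have h2 : ∑ p ∈ Hp μ, supportFn (wulffOf (A (cls μ))) p.1 *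
          (∑ μ' ∈ Finset.univ.erase μ, facetArea (closure (polytope (Hp μ)) ∩ {x : E3 | ⟪p.1, x⟫_ℝ = p.2} ∩
            closure (polytope (Hp μ'))) p.1) ≤
        ∑ μ' ∈ Finset.univ.erase μ, (per (wulffOf (A (cls μ))) (polytope (Hp μ)) +
          per (wulffOf (A (cls μ))) (polytope (Hp μ')) - per (wulffOf (A (cls μ))) (polytope (Hp μ) ∪ polytope (Hp μ'))) / 2 := by
      have hsw : ∑ p ∈ Hp μ, supportFn (wulffOf (A (cls μ))) p.1 *
            (∑ μ' ∈ Finset.univ.erase μ, facetArea (closure (polytope (Hp μ)) ∩ {x : E3 | ⟪p.1, x⟫_ℝ = p.2} ∩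
              closure (polytope (Hp μ'))) p.1) =
          ∑ μ' ∈ Finset.univ.erase μ, ∑ p ∈ Hp μ, supportFn (wulffOf (A (cls μ))) p.1 *
            facetArea (closure (polytope (Hp μ)) ∩ {x : E3 | ⟪p.1, x⟫_ℝ = p.2} ∩ closure (polytope (Hp μ'))) p.1 := by
        simp_rw [Finset.mul_sum]
        exact Finset.sum_comm
      rw [hsw]
      exact Finset.sum_le_sum hpair
    linarith [hAeq, h1, h2]
  · ----------------------------------------------------------------- WALL PART
    obtain ⟨Z, hZ⟩ : ∃ Z : Fin M → Fin M → ℝ, ∀ μ μ', Z μ μ' =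
        if cls μ' ≠ cls μ then c (cls μ) (cls μ') / 2 *
          ∑ p ∈ Hp μ, supportFn (wallBody (m (cls μ) (cls μ'))) p.1 *
            facetArea (closure (polytope (Hp μ)) ∩ {x : E3 | ⟪p.1, x⟫_ℝ = p.2} ∩ closure (polytope (Hp μ'))) p.1
        else 0 := ⟨_, fun _ _ => rfl⟩
    have hZ0 : ∀ μ μ', 0 ≤ Z μ μ' := by
      intro μ μ'
      rw [hZ]
      split_ifs with h
      · exact mul_nonneg (div_nonneg (hc _ _ (Ne.symm h)) (by norm_num))
          (Finset.sum_nonneg fun p _ => mul_nonneg (supportFn_nonneg (isCompact_wallBody _) (zero_mem_wallBody _) _)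
            (facetArea_nonneg _ _))
      · exact le_rfl
    -- the target is the full double sum of `Z`
    have hR : (∑ μ, ∑ μ' ∈ Finset.univ.filter (fun μ' => cls μ' ≠ cls μ), c (cls μ) (cls μ') / 2 *
        ∑ p ∈ Hp μ, supportFn (wallBody (m (cls μ) (cls μ'))) p.1 *
          facetArea (closure (polytope (Hp μ)) ∩ {x : E3 | ⟪p.1, x⟫_ℝ = p.2} ∩ closure (polytope (Hp μ'))) p.1) =
        ∑ μ, ∑ μ', Z μ μ' := by
      refine Finset.sum_congr rfl fun μ _ => ?_
      rw [Finset.sum_filter]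
      exact Finset.sum_congr rfl fun μ' _ => (hZ μ μ').symm
    -- regroup the pieces by class
    have hfib : (∑ μ, ∑ μ', Z μ μ') = ∑ ℓ, ∑ ℓ', ∑ μ ∈ Finset.univ.filter (fun μ => cls μ = ℓ),
        ∑ μ' ∈ Finset.univ.filter (fun μ' => cls μ' = ℓ'), Z μ μ' := by
      rw [← Finset.sum_fiberwise Finset.univ cls (fun μ => ∑ μ', Z μ μ')]
      refine Finset.sum_congr rfl fun ℓ _ => ?_
      conv_rhs => rw [Finset.sum_comm]
      refine Finset.sum_congr rfl fun μ _ => ?_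
      exact (Finset.sum_fiberwise Finset.univ cls (fun μ' => Z μ μ')).symm
    rw [hR, hfib]
    refine Finset.sum_le_sum fun ℓ _ => Finset.sum_le_sum fun ℓ' _ => ?_
    by_cases hℓ : ℓ = ℓ'
    · rw [if_pos hℓ]
      exact Finset.sum_nonneg fun μ _ => Finset.sum_nonneg fun μ' _ => hZ0 μ μ'
    · rw [if_neg hℓ]
      have hIJ : Disjoint (Finset.univ.filter (fun μ => cls μ = ℓ)) (Finset.univ.filter (fun μ' => cls μ' = ℓ')) := by
        rw [Finset.disjoint_filter]
        intro μ _ h1 h2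
        exact hℓ (h1.symm.trans h2)
      have hbil : per (wallBody (m ℓ ℓ')) (G ℓ) + per (wallBody (m ℓ ℓ')) (G ℓ') - per (wallBody (m ℓ ℓ')) (G ℓ ∪ G ℓ') =
          ∑ μ ∈ Finset.univ.filter (fun μ => cls μ = ℓ), ∑ μ' ∈ Finset.univ.filter (fun μ' => cls μ' = ℓ'),
            (per (wallBody (m ℓ ℓ')) (polytope (Hp μ)) + per (wallBody (m ℓ ℓ')) (polytope (Hp μ')) -
              per (wallBody (m ℓ ℓ')) (polytope (Hp μ) ∪ polytope (Hp μ'))) := by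
        rw [hG ℓ, hG ℓ']
        exact two_iota_biUnion_biUnion (fun μ => polytope (Hp μ)) hPoly hvol hdisj (isCompact_wallBody (m ℓ ℓ'))
          (convex_wallBody _) (zero_mem_wallBody _) (neg_wallBody _) hIJ
      have hc2 : 0 ≤ c ℓ ℓ' / 2 := div_nonneg (hc ℓ ℓ' hℓ) (by norm_num)
      rw [hbil, Finset.sum_div, Finset.mul_sum]
      refine Finset.sum_le_sum fun μ hμ => ?_
      rw [Finset.sum_div, Finset.mul_sum]
      refine Finset.sum_le_sum fun μ' hμ' => ?_
      have h1 : cls μ = ℓ := (Finset.mem_filter.1 hμ).2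
      have h2 : cls μ' = ℓ' := (Finset.mem_filter.1 hμ').2
      have hne : μ ≠ μ' := fun h => hℓ (h1.symm.trans (h ▸ h2))
      have hpr := iota_pair_le_facetSum (isCompact_wallBody (m ℓ ℓ')) (convex_wallBody _) (zero_mem_wallBody _)
        (neg_wallBody _) (hbd μ) (hbd μ') (hunit μ) (hdisj μ μ' hne)
      rw [hZ, h1, h2, if_pos (Ne.symm hℓ)]
      exact mul_le_mul_of_nonneg_left hpr hc2

end Summit.Ventures.Crystal3D.Cruxes.TextureLiminf.TexShadow

end
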